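import Literature.MathematicalPhysics.QuantumFieldTheory.Balaban1983to89.B11Ineq190Actual
import Literature.MathematicalPhysics.QuantumFieldTheory.Balaban1983to89.B11Prop3Model

/-!
# `Balaban1983to89.B11Ineq190FromProp3` — T. Bałaban, *The variational problem and background fields in renormalization group method for
lattice gauge theories*, Commun. Math. Phys. **102** (1985) 277–309 [Balaban1985Variational], Sect. G (179)/(182)/(190) pp. 306–308 with
Sect. C Proposition 3 p. 289: **THE SECT. C LETTERS OF THE END-TO-END (190) DISCHARGED FROM PROPOSITION 3** — in `B11Ineq190Actual` (r08 g10)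
the (179) chart is `𝓗 = Tm(𝒜₀ + H₀B)` with the transformation (47) `Tm = A′ ↦ A′ − HD(A′)` entering through three letters: `hTm` («defined and
analytic», Prop. 3), `hTm0` (`Tm 0 = 0`, from (55) `|D(A′)| ≤ 4C₂|A′|²`), and the differentiability of `D` at the points `𝒜₀(B′) + H₀B′` (the
`HasFDerivAt` half of `hDfr`, from (63)–(70)); here `D := B11Prop3Model.Dfix` (THE solution of (49)) and the three letters are PROVED from
Proposition 3's inputs (44)/(46)/(72) (`B11Prop3Model.Inputs`) + analyticity of `C` + the printed smallness of Prop. 3 + the nesting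
`ε₄ + a ≤ ε₃` of the Sect. G ball in the Sect. C ball (p. 306 «the corresponding formulas (176), (177)»; (121) `2(ε₄ + a) ≤ a₃`)

statement-level skeleton of published theorems with citation tags; proofs where landed; nothing here is a claim about the Yang–Mills mass gap

PDF held: `paper:balaban1985-cmp102-variational-background` (journal page = PDF page + 276); p. 289 [PDF 13] (Prop. 3), pp. 306–308 [PDF 30–32]
(Sect. G) — text layer `p0013.txt`, `p0030.txt`–`p0032.txt` and renders (this lineage, gens 3, 6, 9, 10).

CITATION HEADER / WHAT IS REPRODUCED.  Mega-formalization `lit-balaban`, HOME `run/shared/lean/pub/lit-balaban/`, reader/typer/fold-owner seat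
r08 gen 10 (unit `lit-balaban-r08`).  SKELETON rows **B11.Eq190** / **B11.Prop9** (the clause *«its functional derivative (182) satisfies the
inequalities (190)»*; `B11Ineq190Actual.ineq190_sectG_dom` / `ineq190_and_hmv_supSize_sectG`, p304614) and **B11.Prop3** (*«The transformation
(47) … is defined and analytic for A′ satisfying (43) with ε₃ sufficiently small (e.g. 18C₂B₀dc₁(½)ε₃ ≤ 1, 2ε₃ ≤ c₄) … The function D(A′)
satisfies the bound (55) and its functional derivative satisfies the bound (73)»*, p. 289; `B11Prop3Model`, p252774; concrete `B11Prop3Concrete`,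
p303798).  THE PRINT (p. 306 [30], verbatim): *"The configuration 𝓗 can be represented as 𝓗 = 𝒜₀ + H₀B − HD(𝒜₀ + H₀B), (179)"*; (p. 307 [31])
*"Differentiation of (179) yields (δ/δB)𝓗 = (δ/δB)𝒜₀ + H₀ − H⟨𝔇(𝒜₀ + H₀B), (δ/δB)𝒜₀ + H₀⟩, (182)"*; p. 286 [10]: *"|D(A′)| ≤ … ≤ 4C₂|A′|², (55)
This implies that a power series expansion of D(A′) begins with second order terms"*.

WHAT THIS FILE PROVES (theorems only; kernel-checked, 0 sorry, standard axioms).  Scheme of `B11Ineq190Actual` (complex Banach `𝒳 ∋ B`,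
`𝒴 ∋ A′`, `𝒵`; `𝒢`, `W`, `D2`, `H₀`, `Regime`) with the Sect. C data of `B11Prop3Model` ON THE SAME CARRIERS: `C : 𝒴 → 𝒳` (= `A ↦ C_j(L^jηA)`),
`H : 𝒳 →L[ℂ] 𝒴`, `Inputs C H C₂ C₃ B₀ c₄` ((44)/(46)/(72)), `AnalyticOnNhd ℂ C {‖Y‖ < 2c₄}` ((44) «analytic function»), the Prop. 3 smallness
`18C₂B₀ε₃ ≤ 1`, `2ε₃ ≤ c₄`, and `D := Dfix C H C₂`, `Tm := Y ↦ Y − H(Dfix C H C₂ Y)`.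
* §1 `Dfix_zero` (`D(0) = 0` from (55)), **`Tm_zero`** (`Tm 0 = 0` — the letter `hTm0`); **`analyticOnNhd_Tm`** (`Tm` analytic on `‖Y‖ < ε₃`, from
  `B12LinearizAnalytic267.analyticOnNhd_Dt` — the letter `hTm` once `ε₄ + a ≤ ε₃`); **`hasFDerivAt_Dfix_arg180`** (`D` is Fréchet-differentiable
  at `𝒜₀(B′) + H₀B′` for `B′` in the domain of (180), since `‖𝒜₀(B′) + H₀B′‖ < ε₄ + a ≤ ε₃` — the differentiability half of `hDfr`).
* §2 **`ineq190_sectG_dom_of_inputs`** — `B11Ineq190Actual.ineq190_sectG_dom` with `D := Dfix C H C₂` and the `hDfr` letter reduced to the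
  (73)-MAJORANT of the actual derivative `fderiv ℂ (Dfix C H C₂) (𝒜₀(B′) + H₀B′)` (decay letter only; differentiability proved);
  **`ineq190_and_hmv_supSize_of_inputs`** — `B11Ineq190Actual.ineq190_and_hmv_supSize_sectG` with `hTm`, `hTm0` and the differentiability half
  of `hDfr` DISCHARGED from Prop. 3's inputs: the B14/B15 consumers' pair `(h190 on supSize, hmv)` from the located leaves + `Inputs` + analyticity
  of `C` + the two printed smallness regimes + `ε₄ + a ≤ ε₃`.

HONEST SCOPE.  Assembly (this lineage's `B11Prop3Model` g6, `B11Ineq190Actual` g10; `B12LinearizAnalytic267`); for the CONCRETE `C_j` of [4] the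
hypotheses `Inputs`/analyticity are theorems (`B11Prop3Concrete.inputs_concrete`, p06 `B12SecondOrder267Concrete.analyticOnNhd_Cmap`) on the
carriers `𝔸^S`/`𝔸^T`, where the Sect. G data would have to be given — not instantiated here.  NOT discharged: (189), the kernel letters of
G̃/H₀/H/Δ⁽²⁾H₀ and the (73) DECAY letter for `𝔇` (norm level only is Prop. 3's; decay = `B11Eq73KernelDecay.ineq73` from (71)), Lemma 2.1,
(2.54), (187) smallness, size↔norm compatibility, the Sect. G `Regime` and `W`-analyticity; the nesting `ε₄ + a ≤ ε₃` is a stated hypothesis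
(print runs Sects. A–E «for this pair» with the same ε's, p. 305).  No lattice object; NE9 socket C19′ frozen; not summit progress.  Imports
`B11Ineq190Actual`, `B11Prop3Model`; modifies nothing; no new named fact (net debt delta 0).
-/

noncomputable section

namespace Literature.MathematicalPhysics.QuantumFieldTheory.Balaban1983to89.B11Ineq190FromProp3

open Literature.MathematicalPhysics.QuantumFieldTheory.Balaban1983to89
open B11SectG B11Eq174Chart B11Eq183Differentiation B11Presentation190 B11SupSize190 B11Ineq190Actual B11Prop3Model
  B13Contraction113 B6RandomWalk Set Metric

section Scheme

variable {𝒳 𝒴 : Type*} [NormedAddCommGroup 𝒳] [NormedSpace ℂ 𝒳] [NormedAddCommGroup 𝒴] [NormedSpace ℂ 𝒴]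
  [CompleteSpace 𝒳] [CompleteSpace 𝒴] {C : 𝒴 → 𝒳} {H : 𝒳 →L[ℂ] 𝒴} {C₂ C₃ B₀ c₄ ε₃ : ℝ}

/-! ## §1 The Sect. C transformation `Tm = A′ ↦ A′ − HD(A′)` with `D = Dfix`: zero at zero, analytic, differentiable -/

omit [CompleteSpace 𝒴] in
/-- **`D(0) = 0`** — (55) *«|D(A′)| ≤ 4C₂|A′|²»* at `A′ = 0` (*«a power series expansion of D(A′) begins with second order terms»*, p. 286),
for the selector `Dfix` under Prop. 3's inputs and smallness. [cite: Balaban1985Variational, (55) p.286, Prop. 3 p.289] -/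
theorem Dfix_zero (hin : Inputs C (H : 𝒳 →ₗ[ℂ] 𝒴) C₂ C₃ B₀ c₄) (hC₂ : 0 ≤ C₂) (hB₀ : 0 ≤ B₀) (hε₃ : 0 < ε₃)
    (h18 : 18 * C₂ * B₀ * ε₃ ≤ 1) (h2 : 2 * ε₃ ≤ c₄) : Dfix C (H : 𝒳 →ₗ[ℂ] 𝒴) C₂ 0 = 0 := by
  have hc₄ : 0 < c₄ := by linarith
  obtain ⟨hq, -, hRC, -⟩ := smallness hC₂ hB₀ hε₃.le le_rfl le_rfl hc₄ (by simpa using h18) h2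
  have h := (Dfix_spec hin.quadAnalytic hC₂ hB₀ hin.norm_H hq hRC (A := (0 : 𝒴)) (by simpa using hε₃)).1
  have h0 : ‖Dfix C (H : 𝒳 →ₗ[ℂ] 𝒴) C₂ 0‖ ≤ 0 := by simpa using h
  exact norm_le_zero_iff.mp h0

omit [CompleteSpace 𝒴] in
/-- **`Tm 0 = 0`** for `Tm = A′ ↦ A′ − HD(A′)` — the letter `hTm0` of `B11Ineq190Actual.ineq190_and_hmv_supSize_sectG`.
[cite: Balaban1985Variational, (47) p.285, (55) p.286] -/
theorem Tm_zero (hin : Inputs C (H : 𝒳 →ₗ[ℂ] 𝒴) C₂ C₃ B₀ c₄) (hC₂ : 0 ≤ C₂) (hB₀ : 0 ≤ B₀) (hε₃ : 0 < ε₃)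
    (h18 : 18 * C₂ * B₀ * ε₃ ≤ 1) (h2 : 2 * ε₃ ≤ c₄) :
    (0 : 𝒴) - H (Dfix C (H : 𝒳 →ₗ[ℂ] 𝒴) C₂ 0) = 0 := by
  rw [Dfix_zero hin hC₂ hB₀ hε₃ h18 h2, map_zero, sub_zero]

/-- **«defined and analytic» (Prop. 3) for `Tm = A′ ↦ A′ − HD(A′)` in the Fréchet sense**: with `C` analytic on the ball `‖Y‖ < 2c₄` ((44) «it is
an analytic function of A»), `D = Dfix` is analytic on `‖A′‖ < ε₃` (`B12LinearizAnalytic267.analyticOnNhd_Dt`, p. 286 «an analytic function of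
A′»), hence so is `Tm`. [cite: Balaban1985Variational, Prop. 3 p.289, (54) p.286] -/
theorem analyticOnNhd_Tm (hin : Inputs C (H : 𝒳 →ₗ[ℂ] 𝒴) C₂ C₃ B₀ c₄) (hCa : AnalyticOnNhd ℂ C {Y : 𝒴 | ‖Y‖ < 2 * c₄})
    (hC₂ : 0 ≤ C₂) (hB₀ : 0 ≤ B₀) (hε₃ : 0 < ε₃) (h18 : 18 * C₂ * B₀ * ε₃ ≤ 1) (h2 : 2 * ε₃ ≤ c₄) :
    AnalyticOnNhd ℂ (fun Y : 𝒴 => Y - H (Dfix C (H : 𝒳 →ₗ[ℂ] 𝒴) C₂ Y)) {Y : 𝒴 | ‖Y‖ < ε₃} := by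
  have hc₄ : 0 < c₄ := by linarith
  obtain ⟨hq, -, hRC, -⟩ := smallness hC₂ hB₀ hε₃.le le_rfl le_rfl hc₄ (by simpa using h18) h2
  have hQ := hin.quadAnalytic
  have hD : AnalyticOnNhd ℂ (Dfix C (H : 𝒳 →ₗ[ℂ] 𝒴) C₂) (ball (0 : 𝒴) ε₃) :=
    B12LinearizAnalytic267.analyticOnNhd_Dt hQ hCa hC₂ hB₀ hin.norm_H hq hRC
      (Dfix_ball hQ hC₂ hB₀ hin.norm_H hq hRC) (Dfix_fix hQ hC₂ hB₀ hin.norm_H hq hRC)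
  intro Y hY
  have hY' : Y ∈ ball (0 : 𝒴) ε₃ := mem_ball_zero_iff.mpr hY
  exact analyticAt_id.sub (H.analyticAt _ |>.comp (hD Y hY'))

/-- `Tm` analytic on the Sect. G ball `‖Y‖ < ε₄ + a` once it is nested in the Sect. C ball (`ε₄ + a ≤ ε₃`) — the letter `hTm`.
[cite: Balaban1985Variational, Prop. 3 p.289, (176)–(177) p.306] -/
theorem analyticOnNhd_Tm_of_le (hin : Inputs C (H : 𝒳 →ₗ[ℂ] 𝒴) C₂ C₃ B₀ c₄) (hCa : AnalyticOnNhd ℂ C {Y : 𝒴 | ‖Y‖ < 2 * c₄})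
    (hC₂ : 0 ≤ C₂) (hB₀ : 0 ≤ B₀) (hε₃ : 0 < ε₃) (h18 : 18 * C₂ * B₀ * ε₃ ≤ 1) (h2 : 2 * ε₃ ≤ c₄) {ε₄ a : ℝ}
    (hnest : ε₄ + a ≤ ε₃) :
    AnalyticOnNhd ℂ (fun Y : 𝒴 => Y - H (Dfix C (H : 𝒳 →ₗ[ℂ] 𝒴) C₂ Y)) {Y : 𝒴 | ‖Y‖ < ε₄ + a} :=
  (analyticOnNhd_Tm hin hCa hC₂ hB₀ hε₃ h18 h2).mono fun Y (hY : ‖Y‖ < ε₄ + a) => show ‖Y‖ < ε₃ from hY.trans_le hnest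

/-- **`D = Dfix` is Fréchet-differentiable at every point of the ball `‖A′‖ < ε₃`** ((63)–(70): `B11Prop3Model.norm_fderiv_Dfix_le`), in
particular at the points `𝒜₀(B′) + H₀B′` of (182) — the differentiability half of the letter `hDfr`. [cite: Balaban1985Variational, (63)–(70) pp.287–289] -/
theorem hasFDerivAt_Dfix_of_lt (hin : Inputs C (H : 𝒳 →ₗ[ℂ] 𝒴) C₂ C₃ B₀ c₄) (hC₂ : 0 ≤ C₂) (hC₃ : 0 ≤ C₃) (hB₀ : 0 ≤ B₀)
    (hε₃ : 0 < ε₃) (h18 : 18 * C₂ * B₀ * ε₃ ≤ 1) (h2 : 2 * ε₃ ≤ c₄) {A' : 𝒴} (hA' : ‖A'‖ < ε₃) :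
    HasFDerivAt (Dfix C (H : 𝒳 →ₗ[ℂ] 𝒴) C₂) (fderiv ℂ (Dfix C (H : 𝒳 →ₗ[ℂ] 𝒴) C₂) A') A' :=
  (norm_fderiv_Dfix_le hin hC₂ hC₃ hB₀ hε₃ h18 h2 hA').1

end Scheme

/-! ## §2 The end-to-end (190) with the Sect. C letters discharged from Proposition 3 -/

section EndToEnd

variable {𝒳 𝒴 𝒵 : Type} [NormedAddCommGroup 𝒳] [NormedSpace ℂ 𝒳] [NormedAddCommGroup 𝒴] [NormedSpace ℂ 𝒴]
  [NormedAddCommGroup 𝒵] [NormedSpace ℂ 𝒵] [CompleteSpace 𝒳] [CompleteSpace 𝒴] [CompleteSpace 𝒵]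
  {𝒢 : 𝒵 →L[ℂ] 𝒴} {W : 𝒴 → 𝒵} {D2 : 𝒴 →L[ℂ] 𝒵} {H₀ : 𝒳 →L[ℂ] 𝒴} {B₀ θ C₄ a₃ j a ε₄ : ℝ}
  {C : 𝒴 → 𝒳} {H : 𝒳 →L[ℂ] 𝒴} {C₂ C₃ B₀' c₄ ε₃ : ℝ} {g : B6.Geometry}

omit [CompleteSpace 𝒳] [CompleteSpace 𝒵] in
/-- the points `𝒜₀(B′) + H₀B′` of (182) lie in the Sect. C ball when `ε₄ + a ≤ ε₃`. [cite: Balaban1985Variational, (179)–(180) p.306] -/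
theorem norm_arg180_lt_eps3 (R : Regime 𝒢 0 W B₀ θ C₄ a₃ j a ε₄) {B : 𝒳} (hJ : ‖D2 (H₀ B)‖ < j) (h𝔄 : ‖H₀ B‖ < a)
    (hnest : ε₄ + a ≤ ε₃) : ‖solA180 𝒢 W D2 H₀ ε₄ B + H₀ B‖ < ε₃ :=
  (B11Prop6Scheme.norm_arg_lt h𝔄 (eq180 R hJ.le h𝔄).2).trans_le hnest

/-- **(190) on the domain of (180) for the actual derivative, `D := Dfix` of Prop. 3** — `B11Ineq190Actual.ineq190_sectG_dom` with the
differentiability of `D` at the points `𝒜₀(B′) + H₀B′` PROVED (Prop. 3 inputs + smallness + `ε₄ + a ≤ ε₃`); the letter left for `𝔇` is the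
(73)-MAJORANT of the actual derivative `fderiv ℂ (Dfix C H C₂) (𝒜₀(B′) + H₀B′)` on the domain. [cite: Balaban1985Variational, (190) p.308, Prop. 3 p.289, (73) p.289] -/
theorem ineq190_sectG_dom_of_inputs (R : Regime 𝒢 0 W B₀ θ C₄ a₃ j a ε₄) (hWa : AnalyticOnNhd ℂ W {Y : 𝒴 | ‖Y‖ < a₃})
    (hin : Inputs C (H : 𝒳 →ₗ[ℂ] 𝒴) C₂ C₃ B₀' c₄) (hC₂ : 0 ≤ C₂) (hC₃ : 0 ≤ C₃) (hB₀' : 0 ≤ B₀') (hε₃ : 0 < ε₃)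
    (h18 : 18 * C₂ * B₀' * ε₃ ≤ 1) (h2 : 2 * ε₃ ≤ c₄) (hnest : ε₄ + a ≤ ε₃)
    {bB : BlockNorm g 𝒳} {bN : BlockNorm g 𝒴} {b3 : BlockNorm g 𝒵}
    (hN : ∀ (y : g.Site) (v : 𝒴), bN.loc y v ≤ ‖v‖) (hBloc : ∀ (y' : g.Site) (μ : 𝒳), bB.IsLoc y' μ → ‖μ‖ ≤ bB.loc y' μ)
    {δ₀ BG θW cΔ A₀ AH θD c : ℝ}
    (htri : Triangle254 g) (hd : ∀ a b : g.Site, 0 ≤ g.dist a b) (hδ₀ : 0 ≤ δ₀) (hrow : RowSum g (δ₀ / 8) c)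
    (hc : 0 ≤ c) (hBG : 0 ≤ BG) (hθW : 0 ≤ θW) (hcΔ : 0 ≤ cΔ) (hA₀ : 0 ≤ A₀) (hAH : 0 ≤ AH) (hθD : 0 ≤ θD)
    (hG : HasMaj b3 bN (𝒢.restrictScalars ℝ : 𝒵 →ₗ[ℝ] 𝒴) (fun y y' => BG * Real.exp (-(δ₀ * g.dist y y'))))
    (hD2H0 : HasMaj bB b3 ((D2 ∘L H₀).restrictScalars ℝ : 𝒳 →ₗ[ℝ] 𝒵) (fun y y' => cΔ * Real.exp (-(δ₀ * g.dist y y'))))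
    (hH0 : HasMaj bB bN (H₀.restrictScalars ℝ : 𝒳 →ₗ[ℝ] 𝒴) (fun y y' => A₀ * Real.exp (-(δ₀ * g.dist y y'))))
    (hH : HasMaj bB bN (H.restrictScalars ℝ : 𝒳 →ₗ[ℝ] 𝒴) (fun y y' => AH * Real.exp (-(δ₀ / 2 * g.dist y y'))))
    (h189 : ∀ B' : 𝒳, ‖H₀ B'‖ < a → ‖D2 (H₀ B')‖ < j →
      Ineq189 bN b3 ((fderiv ℂ W (solA180 𝒢 W D2 H₀ ε₄ B' + H₀ B')).restrictScalars ℝ : 𝒴 →ₗ[ℝ] 𝒵) θW δ₀)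
    (h73 : ∀ B' : 𝒳, ‖H₀ B'‖ < a → ‖D2 (H₀ B')‖ < j →
      HasMaj bN bB ((fderiv ℂ (Dfix C (H : 𝒳 →ₗ[ℂ] 𝒴) C₂) (solA180 𝒢 W D2 H₀ ε₄ B' + H₀ B')).restrictScalars ℝ : 𝒴 →ₗ[ℝ] 𝒳)
        (fun y y' => θD * Real.exp (-(δ₀ / 2 * g.dist y y'))))
    (hq : qG b3.κ bN.κ BG θW c < 1) :
    ∀ B' : 𝒳, ‖H₀ B'‖ < a → ‖D2 (H₀ B')‖ < j →
      Ineq190 bB bN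
        ((fderiv ℂ (chartH179 𝒢 W D2 H₀ (fun Y : 𝒴 => Y - H (Dfix C (H : 𝒳 →ₗ[ℂ] 𝒴) C₂ Y)) ε₄) B').restrictScalars ℝ :
          𝒳 →ₗ[ℝ] 𝒴)
        (const190 bB.κ bN.κ b3.κ BG θW cΔ A₀ AH θD c) δ₀ :=
  ineq190_sectG_dom R hWa H hN hBloc htri hd hδ₀ hrow hc hBG hθW hcΔ hA₀ hAH hθD hG hD2H0 hH0 hH h189
    (fun B' h𝔄 hJ => ⟨_, hasFDerivAt_Dfix_of_lt hin hC₂ hC₃ hB₀' hε₃ h18 h2 (norm_arg180_lt_eps3 R hJ h𝔄 hnest),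
      h73 B' h𝔄 hJ⟩) hq

variable {X : Type} {E : Type} [NormedAddCommGroup E] [NormedSpace ℝ E] {box : g.Site → Finset X} {blk : X → g.Site}

/-- **END TO END FOR THE SUP SIZE with the Sect. C letters from Proposition 3** — `B11Ineq190Actual.ineq190_and_hmv_supSize_sectG` with
`Tm := Y ↦ Y − H(Dfix C H C₂ Y)`: its letters `hTm` (analyticity on `‖Y‖ < ε₄ + a`), `hTm0` (`Tm 0 = 0`) and the differentiability half of
`hDfr` are DISCHARGED from `Inputs C H C₂ C₃ B₀′ c₄` ((44)/(46)/(72)), `AnalyticOnNhd ℂ C {‖Y‖ < 2c₄}`, the Prop. 3 smallness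
(`18C₂B₀′ε₃ ≤ 1`, `2ε₃ ≤ c₄`) and `ε₄ + a ≤ ε₃`; conclusion: the B14/B15 consumers' pair `(∀ t ∈ [0,1], Ineq190 bB (supSize g box blk) (dH t)
const190 δ₀) ∧ hmv` for any lattice presentation of the (179) chart. [cite: Balaban1985Variational, Prop. 9 (190) pp.308–309, Prop. 3 p.289,
(179)–(180) p.306] -/
theorem ineq190_and_hmv_supSize_of_inputs (R : Regime 𝒢 0 W B₀ θ C₄ a₃ j a ε₄) (hWa : AnalyticOnNhd ℂ W {Y : 𝒴 | ‖Y‖ < a₃})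
    (hin : Inputs C (H : 𝒳 →ₗ[ℂ] 𝒴) C₂ C₃ B₀' c₄) (hCa : AnalyticOnNhd ℂ C {Y : 𝒴 | ‖Y‖ < 2 * c₄})
    (hC₂ : 0 ≤ C₂) (hC₃ : 0 ≤ C₃) (hB₀' : 0 ≤ B₀') (hε₃ : 0 < ε₃) (h18 : 18 * C₂ * B₀' * ε₃ ≤ 1) (h2 : 2 * ε₃ ≤ c₄)
    (hnest : ε₄ + a ≤ ε₃)
    {B : 𝒳} (hB : ‖H₀ B‖ < a ∧ ‖D2 (H₀ B)‖ < j) (ev : X → (𝒴 →L[ℝ] E))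
    {bB : BlockNorm g 𝒳} {bN : BlockNorm g 𝒴} {b3 : BlockNorm g 𝒵}
    (hev : ∀ (y : g.Site) (v : 𝒴), ∀ x ∈ box y, ‖ev x v‖ ≤ bN.loc y v)
    (hN : ∀ (y : g.Site) (v : 𝒴), bN.loc y v ≤ ‖v‖) (hBloc : ∀ (y' : g.Site) (μ : 𝒳), bB.IsLoc y' μ → ‖μ‖ ≤ bB.loc y' μ)
    {δ₀ BG θW cΔ A₀ AH θD c : ℝ}
    (htri : Triangle254 g) (hd : ∀ a b : g.Site, 0 ≤ g.dist a b) (hδ₀ : 0 ≤ δ₀) (hrow : RowSum g (δ₀ / 8) c)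
    (hc : 0 ≤ c) (hBG : 0 ≤ BG) (hθW : 0 ≤ θW) (hcΔ : 0 ≤ cΔ) (hA₀ : 0 ≤ A₀) (hAH : 0 ≤ AH) (hθD : 0 ≤ θD)
    (hG : HasMaj b3 bN (𝒢.restrictScalars ℝ : 𝒵 →ₗ[ℝ] 𝒴) (fun y y' => BG * Real.exp (-(δ₀ * g.dist y y'))))
    (hD2H0 : HasMaj bB b3 ((D2 ∘L H₀).restrictScalars ℝ : 𝒳 →ₗ[ℝ] 𝒵) (fun y y' => cΔ * Real.exp (-(δ₀ * g.dist y y'))))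
    (hH0 : HasMaj bB bN (H₀.restrictScalars ℝ : 𝒳 →ₗ[ℝ] 𝒴) (fun y y' => A₀ * Real.exp (-(δ₀ * g.dist y y'))))
    (hH : HasMaj bB bN (H.restrictScalars ℝ : 𝒳 →ₗ[ℝ] 𝒴) (fun y y' => AH * Real.exp (-(δ₀ / 2 * g.dist y y'))))
    (h189 : ∀ B' : 𝒳, ‖H₀ B'‖ < a → ‖D2 (H₀ B')‖ < j →
      Ineq189 bN b3 ((fderiv ℂ W (solA180 𝒢 W D2 H₀ ε₄ B' + H₀ B')).restrictScalars ℝ : 𝒴 →ₗ[ℝ] 𝒵) θW δ₀)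
    (h73 : ∀ B' : 𝒳, ‖H₀ B'‖ < a → ‖D2 (H₀ B')‖ < j →
      HasMaj bN bB ((fderiv ℂ (Dfix C (H : 𝒳 →ₗ[ℂ] 𝒴) C₂) (solA180 𝒢 W D2 H₀ ε₄ B' + H₀ B')).restrictScalars ℝ : 𝒴 →ₗ[ℝ] 𝒳)
        (fun y y' => θD * Real.exp (-(δ₀ / 2 * g.dist y y'))))
    (hq : qG b3.κ bN.κ BG θW c < 1)
    (Hl : 𝒳 → X → E) (dH : Icc (0:ℝ) 1 → 𝒳 →ₗ[ℝ] (X → E))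
    (hHl : ∀ B' : 𝒳, Hl B' = fun x => ev x (chartH179 𝒢 W D2 H₀ (fun Y : 𝒴 => Y - H (Dfix C (H : 𝒳 →ₗ[ℂ] 𝒴) C₂ Y)) ε₄ B'))
    (hdH : ∀ t : Icc (0:ℝ) 1, dH t = (LinearMap.pi fun x => ((ev x : 𝒴 →L[ℝ] E) : 𝒴 →ₗ[ℝ] E)) ∘ₗ
      ((fderiv ℂ (chartH179 𝒢 W D2 H₀ (fun Y : 𝒴 => Y - H (Dfix C (H : 𝒳 →ₗ[ℂ] 𝒴) C₂ Y)) ε₄) ((t : ℝ) • B)).restrictScalars ℝ :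
        𝒳 →ₗ[ℝ] 𝒴))
    (y : g.Site) :
    (∀ t : Icc (0:ℝ) 1, Ineq190 bB (supSize g box blk : BlockNorm g (X → E)) (dH t)
        (const190 bB.κ bN.κ b3.κ BG θW cΔ A₀ AH θD c) δ₀) ∧
      ∀ s : ℝ, (∀ t, (supSize g box blk : BlockNorm g (X → E)).loc y (dH t B) ≤ s) →
        (supSize g box blk : BlockNorm g (X → E)).loc y (Hl B) ≤ s :=
  ineq190_and_hmv_supSize_sectG R hWa H (analyticOnNhd_Tm_of_le hin hCa hC₂ hB₀' hε₃ h18 h2 hnest)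
    (Tm_zero hin hC₂ hB₀' hε₃ h18 h2) hB ev hev hN hBloc htri hd hδ₀ hrow hc hBG hθW hcΔ hA₀ hAH hθD hG hD2H0 hH0 hH h189
    (fun B' h𝔄 hJ => ⟨_, hasFDerivAt_Dfix_of_lt hin hC₂ hC₃ hB₀' hε₃ h18 h2 (norm_arg180_lt_eps3 R hJ h𝔄 hnest),
      h73 B' h𝔄 hJ⟩) hq Hl dH hHl hdH y

end EndToEnd

end Literature.MathematicalPhysics.QuantumFieldTheory.Balaban1983to89.B11Ineq190FromProp3

end
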